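import Summits.AnomalousDissipation.AnomalousDissipation.Theorems.MomentParityResolvedDissipationInvariance
import Summits.AnomalousDissipation.AnomalousDissipation.Theorems.CubicParityLoud.Negative.EnergyRow
import Summits.AnomalousDissipation.AnomalousDissipation.Theorems.MomentParityResolvedDissipationStubSmoothCylRow
import Literature.Analysis.FluidPDE.GalerkinFlow

/-!
# Stub `stub_levelCoeff` for line `enstrophy-ui-transfer` (crux `MomentParity.ResolvedDissipation`, stmt-AnomalousDissipation-14284)

S4 of skeleton v3 (lead c4): the dictionary between a level-`N` state `u : H` and the honest
trigonometric polynomial of its Fourier coefficients,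
`a = realTrigPoly (freqBall N) (coeffExt (freqBall N) (û|_{freqBall N}))`.
For EVERY `u : H` the field `a` is a Galerkin mode of order `N`
(`isGalerkinMode_realTrigPoly_coeffExt` on `MomentParity.fourierRestrict_coe_mem_galerkinSubspace`), and
`a = P_N u` (`realTrigPoly_coeffExt_fourierRestrict`). On level-`N` states `P_N u = u` a.e.
(`CubicParityLoud.Negative.fourierTruncate_ae_eq_of_isLevel`), whence `∫ a = ∫ u = 0` (`u ∈ H` is mean-zero,
`Torus.integral_eq_zero_of_mem_energySpace`), `∫ ‖a‖² = ‖u‖²` (landed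
`MomentParityResolvedDissipation.CylRow.integral_norm_sq_fourierTruncate_of_isLevel`), and the spectral enstrophies agree
(`CubicParityLoud.Negative.eGradNormSq_fourierTruncate_of_isLevel`).
-/

noncomputable section

-- `Summit.<Summit>.<Problem>`: single-conjunct summit, the duplicate namespace segment is mandated.
set_option linter.dupNamespace false

namespace Summit.AnomalousDissipation.AnomalousDissipation.Theorems.MomentParityResolvedDissipation.LevelCoeff

open MeasureTheory Filter Topology Set
open scoped ENNReal InnerProductSpace RealInnerProductSpace
open Literature.Analysis.FunctionSpaces Literature.Analysis.FluidPDE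
open Summit.AnomalousDissipation.AnomalousDissipation.Theses.MomentParity
open Summit.AnomalousDissipation.AnomalousDissipation.Theorems.CubicParityLoud.Negative (T3 R3 H3 L2T3)
open Summit.AnomalousDissipation.AnomalousDissipation.Theorems.QuarticGate.Negative
  (IsLevel IsBandTest polyGrad IsPolyStationary)

/-- On a level-`N` state the truncation `P_N u` has zero mean (`P_N u = u` a.e. and `u ∈ H` is mean-zero). -/
theorem hasZeroMean_fourierTruncate_of_isLevel {N : ℕ} {u : H3} (hu : IsLevel N u) :
    Torus.HasZeroMean (Torus.fourierTruncate N (u.1 : T3 → R3)) := by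
  have hu' : CubicParityLoud.Negative.IsLevel N u := hu
  change ∫ x, Torus.fourierTruncate N (u.1 : T3 → R3) x = 0
  rw [integral_congr_ae (CubicParityLoud.Negative.fourierTruncate_ae_eq_of_isLevel hu')]
  exact Torus.integral_eq_zero_of_mem_energySpace u.2

/-- **S4 · `stub_levelCoeff` — a level-`N` state, read through its Fourier coefficients, is a zero-mean Galerkin
mode of order `N` with the same `L²` norm and the same enstrophy.** For `u : H` with `IsLevel N u` put
`c = û|_{freqBall N}` and `a = realTrigPoly (freqBall N) c̄` (`= P_N u`, `realTrigPoly_coeffExt_fourierRestrict`).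
Then `a` is a Galerkin mode of order `N`, `a` has zero mean, `∫‖a‖² = ‖u‖²` and `‖∇a‖² = ‖∇u‖²`. [folklore] -/
theorem stub_levelCoeff :
    ∀ (N : ℕ) (u : H3), IsLevel N u →
      IsGalerkinMode N (Torus.realTrigPoly (Torus.freqBall N)
        (Torus.coeffExt (Torus.freqBall N) (fourierRestrict (Torus.freqBall N) (u.1 : T3 → R3)))) ∧
      Torus.HasZeroMean (Torus.realTrigPoly (Torus.freqBall N)
        (Torus.coeffExt (Torus.freqBall N) (fourierRestrict (Torus.freqBall N) (u.1 : T3 → R3)))) ∧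
      ∫ x, ‖Torus.realTrigPoly (Torus.freqBall N)
        (Torus.coeffExt (Torus.freqBall N) (fourierRestrict (Torus.freqBall N) (u.1 : T3 → R3))) x‖ ^ 2 =
          ‖u‖ ^ 2 ∧
      Torus.eGradNormSq (Torus.realTrigPoly (Torus.freqBall N)
        (Torus.coeffExt (Torus.freqBall N) (fourierRestrict (Torus.freqBall N) (u.1 : T3 → R3)))) =
          Torus.eGradNormSq (u.1 : T3 → R3) := by
  intro N u hu
  have hu' : CubicParityLoud.Negative.IsLevel N u := hu
  refine ⟨isGalerkinMode_realTrigPoly_coeffExt (MomentParity.fourierRestrict_coe_mem_galerkinSubspace N u), ?_⟩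
  rw [realTrigPoly_coeffExt_fourierRestrict]
  exact ⟨hasZeroMean_fourierTruncate_of_isLevel hu, CylRow.integral_norm_sq_fourierTruncate_of_isLevel hu,
    CubicParityLoud.Negative.eGradNormSq_fourierTruncate_of_isLevel hu'⟩

end Summit.AnomalousDissipation.AnomalousDissipation.Theorems.MomentParityResolvedDissipation.LevelCoeff

end
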